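import Summits.QuantumFields.YangMills.Theorems.UnitScaleTiltFluctuationComparisonRegPrGlobalSlackCanonicalPolymersNewTermSplitV4
import Summits.QuantumFields.YangMills.Theorems.UnitScaleTiltFluctuationComparisonRegPrGlobalSlackKernelCauchyEstimates
import Summits.QuantumFields.YangMills.Theorems.UnitScaleTiltFluctuationComparisonRegPrGlobalSlackCanonicalEndToEnd
import Summits.QuantumFields.YangMills.Theorems.UnitScaleTiltFluctuationComparisonRegPrGlobalSlackCanonicalPolymersJetStepInputs
import HarnessLib

/-!
# `UnitScaleTiltFluctuationComparisonRegPrGlobalSlackCanonicalPolymersJetStepInputsV4` — THE v4 TWIN (★★OWNER RULING g26-№14 (F-2b); P22b polymer-step branch, width seat ym-ust-20520-w2 g4; skeleton v5kD; record-free decls imported from `…GlobalSlackCanonicalPolymersJetStepInputs`) of `…GlobalSlackCanonicalPolymersJetStepInputs` — THE DISPLAYED INPUTS OF THE BIRTH-LEVEL KERNEL COMPARISON FOR THE χ-PACKAGE'S OWN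
# STEP CHARTS: BOTH RUNS' KERNEL SIZES (THE TRANSPORTED ONE INCLUDED), THE CONFIGURATION WINDOW, THE COLLAR POLYLOGARITHM, THE PULL-BACK
# (crux `FluctuationComparisonRegPrIntL`, stmt-QuantumFields-20520, skeleton v5kC STUBS 3⁗χ / (i*)χ; width seat ym-ust-20520-w2 on (i*)χ — analytic rows)

WHY.  `…CanonicalPolymersNewTermSplit` (this seat, p584833) leaves the newborn two-run row as the retained-jet row `JetStepSlackOnRows` of the STEP charts (+ the Λ residual).
King's mechanism for it ([King1986] Prop. 3.6: flat-kernel comparison ∘ configuration comparison, lane A's pointwise algebra `jet_re_diff_ml`) consumes, besides the two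
genuinely two-run statements (K1a on the displayed charts; the configuration Cauchy row on the displayed `Bcfg`), four SINGLE-RUN inputs that the χ-package DISPLAYS.  This file
proves those four for the package's own objects, read in the family's bond coordinates so that run `K`, run `K+1` and the bond transport of [Balaban1987RG1] (0.1) live in one
typing (`chartAt`, `cfgAt`; `(T3Scales …).P = F.P K` definitionally):

* `window_cfg_le_one` — the configuration window `cB·r(g_k)g_kp(g_k) ≤ 1` along every run's steps from `γ ≤ gammaθ b₀ (p₀+r₀) (1/max 1 cB)` ((7)/(28));
* `norm_kernelRows_le_of_chart` — KERNEL SIZES WITH THE KEPT COUPLING from the displayed G3D-01 row `chart` and the operator-norm Cauchy inequality (lane A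
  `norm_iteratedFDeriv_zero_le_uniform`): `‖Dᵈ(Ψ^K_{k,X})(0)‖ ≤ C25·(max 1 (12/ρ))⁶·g_k·e^{−κ·dj X}`, `d ≤ 6` — print's (34) for the package's own charts (lane A had it for an
  abstract chart family under the schema `ChartAnalyticGΦ`);
* `norm_kernelTRows_le_of_chart` — THE SAME FOR RUN `K+1`'s KERNEL AT THE TRANSPORTED DOMAIN PULLED BACK ALONG THE TRANSPORT (`gk_succ_eq`, `dj_domCast`, `‖transport‖ ≤ 1`);
* `rsq_mul_rpow_le` — `r(g)²·gᵗ ≤ M(2r₀,t)` (the kept coupling pays `bound28`'s polylogarithm squared); `norm_pullback_le` — the pull-back along the bond matching does not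
  increase the sup norm.
LOCATED (for the successor): composing these with `jet_re_diff_ml` at the package's objects elaborates up to the last step and then hits a definitional-unfolding time-out
between the two instance paths of the multilinear operator norm over `PBond (F.P K) k → 𝔤ᶜ` (seat NOTES, work/JetStep*.lean) — a Lean engineering seam, not mathematics; the
statement to land is `K1aStepΨRows ∧ CfgCauchyStepOnRows ⟹ JetStepSlackOnRows` at rate `a(1−t)`.  Nothing of [Balaban1985UV3]/[King1986] is asserted; no numerics; registry untouched
(`--supports stmt-QuantumFields-20520`).  YM₃ on the torus is a rung of the ladder, not the Clay problem; nothing here is a claim about the crux or the gap.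

References: T. Bałaban, CMP 102 (1985) 255–275 [Balaban1985UV3] ((7) p.257, (25) p.262, (27)–(29) p.263, (33)–(34) p.264); CMP 109 (1987) 249–301 [Balaban1987RG1] ((0.1)
p.251); C. King, CMP 102 (1986) 649–677 [King1986] (Prop. 3.6 (3.55)–(3.56) p.662); S. B. Chae, Holomorphy and Calculus in Normed Spaces (1985) [Chae1985] (13.6).
-/

set_option autoImplicit false

noncomputable section

namespace Summit.QuantumFields.YangMills.Theorems.GlobalSlackCanonicalPolymers

open scoped BigOperators
open Finset
open Literature.MathematicalPhysics.QuantumFieldTheory.Balaban1983to89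
open Literature.MathematicalPhysics.QuantumFieldTheory.Balaban1983to89.T3ContinuumYM3Torus
open Literature.MathematicalPhysics.QuantumFieldTheory.Balaban1983to89.T3UnitScaleTilt (θBal)
open Literature.MathematicalPhysics.QuantumFieldTheory.Balaban1983to89.T3LevelShift (fieldShift)
open Literature.MathematicalPhysics.QuantumFieldTheory.Balaban1983to89.T3Thresholds (θBal_succ_le)
open Literature.MathematicalPhysics.QuantumFieldTheory.Balaban1983to89.T3AlphaInputsAC
open Literature.MathematicalPhysics.QuantumFieldTheory.Balaban1983to89.T3AlphaPolymerSocket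
open Literature.MathematicalPhysics.QuantumFieldTheory.Balaban1983to89.T3AlphaInputsACTwoRunLevel
open Literature.MathematicalPhysics.QuantumFieldTheory.Balaban1983to89.TreeLengthTorus (tsys TPt)
open Literature.MathematicalPhysics.QuantumFieldTheory.Balaban1985CMP102
open Literature.MathematicalPhysics.QuantumFieldTheory.Balaban1985CMP102.Setting
open Literature.MathematicalPhysics.QuantumFieldTheory.Balaban1985CMP102.Binders (ChartAnalyticityAsCited)
open Summit.QuantumFields.Balaban3D.Carriers
open Summit.QuantumFields.Balaban3D.Proofs.Primitives
open Summit.QuantumFields.Balaban3D.Proofs.GroupModelLieC (lieC)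
open Summit.QuantumFields.Balaban3D.Proofs.Representation33 (jet26)
open Summit.QuantumFields.Balaban3D.Proofs.NewbornJet (rFun_pow)
open Summit.QuantumFields.Balaban3D.Proofs.ScalesArithmetic (gk_pos gk_le_one)
open Summit.QuantumFields.YangMills.Theorems
open Summit.QuantumFields.YangMills.Theorems.GlobalSlackKernelMatching
open Summit.QuantumFields.YangMills.Theorems.GlobalSlackKernelMatchingOn (WinPred)
open Summit.QuantumFields.YangMills.Theorems.GlobalSlackKernelRescale (logPowConst logPowConst_pos rpow_mul_logpow_le min_le_rpow_mul_rpow)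

variable {F : T3Family} {𝔠 : AlphaConsts F.L (suGroupModel 2).N} {γ : ℝ} {hγ : 0 < γ} {hγ1 : γ ≤ (min 𝔠.gamma0 1) ^ 2}

/-! ## §1 The displayed step charts and configurations, read in the family's bond coordinates -/

/-- **THE DISPLAYED STEP CHART OF RUN `K` AT STEP `k` AND DOMAIN `X`, READ IN THE FAMILY'S BOND COORDINATES** (`(𝔖 k).Ψ X`; the lane's chart space
`PBond (T3Scales …).P k → 𝔤ᶜ` IS `PBond (F.P K) k → 𝔤ᶜ`, `T3Scales_P`) — so that the two runs' charts, kernels and the bond transport of [Balaban1987RG1] (0.1) live in ONE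
typing. [cite: Balaban1985UV3, (29) p.263, (33) p.264] -/
def chartAtRows (q : ∀ K, AlphaInputsT3AC.PkgCoreRows F 𝔠 γ hγ hγ1 K) (K k : ℕ) (X : (tsys 3 (nblkOf (SK F 𝔠 γ hγ hγ1 K) 𝔠.lane.carrier k)).Dom) :
    (PBond (F.P K) k → ↥(lieC (suGroupModel 2))) → ℂ :=
  ((q K).𝔖 k).Ψ X

/-- **THE DISPLAYED STEP CHART CONFIGURATION OF RUN `K` AT STEP `k`, DOMAIN `X`, TRIVIAL HISTORY AND LEVEL-`(k+1)` FIELD `W`, IN THE FAMILY'S BOND COORDINATES**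
(`(𝔖 k).Bcfg X triv W`, (27)/(28) p.263). [cite: Balaban1985UV3, (27)-(28) p.263, (43) p.266] -/
def cfgAtRows (q : ∀ K, AlphaInputsT3AC.PkgCoreRows F 𝔠 γ hγ hγ1 K) (K k : ℕ) (X : (tsys 3 (nblkOf (SK F 𝔠 γ hγ hγ1 K) 𝔠.lane.carrier k)).Dom)
    (W : GaugeField (F.P K) (k + 1) (Matrix.specialUnitaryGroup (Fin 2) ℂ)) : PBond (F.P K) k → ↥(lieC (suGroupModel 2)) :=
  ((q K).𝔖 k).Bcfg X (Hist.triv (F.P K) (k + 1)) W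

/-! ## §2 The displayed inputs of the birth-level kernel comparison: window, kernel sizes of both runs, polylogarithm, pull-back -/

-- (record-free `window_cfg_le_one`: imported from the v3 module, not restated)

/-- **KERNEL SIZES FROM THE DISPLAYED CHART ROW** (G3D-01 + the operator-norm Cauchy inequality): `‖Dᵈ(Ψ^K_{k,X})(0)‖ ≤ C25·(max 1 (12/ρ))⁶·g_k·e^{−κ·dj X}` for `d ≤ 6`.
[cite: Balaban1985UV3, (25) p.262, Prop. 3 (34) p.264; King1986, (3.55) p.662] -/
theorem norm_kernelRows_le_of_chart (q : ∀ K, AlphaInputsT3AC.PkgCoreRows F 𝔠 γ hγ hγ1 K) (K k : ℕ) (hk : k + 1 ≤ K)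
    (X : (tsys 3 (nblkOf (SK F 𝔠 γ hγ hγ1 K) 𝔠.lane.carrier k)).Dom) {d : ℕ} (hd : d ≤ 6) :
    ‖iteratedFDeriv ℂ d (chartAtRows q K k X) 0‖ ≤
      𝔠.C25 * (max 1 (12 / 𝔠.ρ)) ^ 6 * (SK F 𝔠 γ hγ hγ1 K).gk k * Real.exp (-(𝔠.κ * (tsys 3 (nblkOf (SK F 𝔠 γ hγ hγ1 K) 𝔠.lane.carrier k)).dj X)) := by
  have h := norm_iteratedFDeriv_zero_le_uniform (((q K).runRows.steps k hk).chart X) hd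
  calc ‖iteratedFDeriv ℂ d (chartAtRows q K k X) 0‖
      ≤ 𝔠.C25 * (SK F 𝔠 γ hγ hγ1 K).gk k * Real.exp (-(𝔠.κ * (tsys 3 (nblkOf (SK F 𝔠 γ hγ hγ1 K) 𝔠.lane.carrier k)).dj X)) * (max 1 (12 / 𝔠.ρ)) ^ 6 := h
    _ = _ := by ring

/-- **THE TRANSPORTED KERNEL OF RUN `K+1` HAS THE SAME SIZE** (run `K+1`'s chart row at the transported domain, `gk_succ_eq`, `dj_domCast`, `‖transport‖ ≤ 1`).
[cite: King1986, Prop. 3.6 (3.56) p.662; Balaban1985UV3, (34) p.264] -/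
theorem norm_kernelTRows_le_of_chart (q : ∀ K, AlphaInputsT3AC.PkgCoreRows F 𝔠 γ hγ hγ1 K) (K k : ℕ) (hk : k + 1 ≤ K)
    (X : (tsys 3 (nblkOf (SK F 𝔠 γ hγ hγ1 K) 𝔠.lane.carrier k)).Dom) {d : ℕ} (hd : d ≤ 6) :
    ‖(iteratedFDeriv ℂ d (chartAtRows q (K + 1) (k + 1) (domCast (nblkOf_succ_eq (hγ := hγ) (hγ1 := hγ1) K k) X)) 0).compContinuousLinearMap
        (fun _ => transport ↥(lieC (suGroupModel 2)) F K k)‖ ≤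
      𝔠.C25 * (max 1 (12 / 𝔠.ρ)) ^ 6 * (SK F 𝔠 γ hγ hγ1 K).gk k * Real.exp (-(𝔠.κ * (tsys 3 (nblkOf (SK F 𝔠 γ hγ hγ1 K) 𝔠.lane.carrier k)).dj X)) := by
  have h := norm_kernelRows_le_of_chart q (K + 1) (k + 1) (by omega) (domCast (nblkOf_succ_eq (hγ := hγ) (hγ1 := hγ1) K k) X) hd
  rw [dj_domCast, gk_succ_eq (hγ := hγ) (hγ1 := hγ1) K k (by omega)] at h
  have ht : ‖transport ↥(lieC (suGroupModel 2)) F K k‖ ≤ 1 :=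
    ContinuousLinearMap.opNorm_le_bound _ zero_le_one fun x => by
      rw [one_mul]
      exact norm_transport_le K k x
  have hprod : ∏ _i : Fin d, ‖transport ↥(lieC (suGroupModel 2)) F K k‖ ≤ 1 :=
    Finset.prod_le_one (fun _ _ => norm_nonneg (transport ↥(lieC (suGroupModel 2)) F K k)) (fun _ _ => ht)
  set M := iteratedFDeriv ℂ d (chartAtRows q (K + 1) (k + 1) (domCast (nblkOf_succ_eq (hγ := hγ) (hγ1 := hγ1) K k) X)) 0 with hMdef
  have hM0 : 0 ≤ ‖M‖ := norm_nonneg M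
  calc ‖M.compContinuousLinearMap (fun _ => transport ↥(lieC (suGroupModel 2)) F K k)‖
      ≤ ‖M‖ * ∏ _i : Fin d, ‖transport ↥(lieC (suGroupModel 2)) F K k‖ := ContinuousMultilinearMap.norm_compContinuousLinearMap_le _ _
    _ ≤ ‖M‖ * 1 := mul_le_mul_of_nonneg_left hprod hM0
    _ ≤ _ := by rw [mul_one]; exact h

-- (record-free `rsq_mul_rpow_le`: imported from the v3 module, not restated)

-- (record-free `norm_pullback_le`: imported from the v3 module, not restated)

end Summit.QuantumFields.YangMills.Theorems.GlobalSlackCanonicalPolymers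

end
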